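import Literature.Topology.FourManifolds.ExitBend
import Literature.Topology.FourManifolds.CollarUniquenessBall
import HarnessLib

/-!
# Level geometry of the excursion plane at a crossing

Topic `Literature/Topology/FourManifolds` (trunk T-4MAN). Fact seat
`provefact-Literature.Topology.FourManifolds.Knot.IsConnectedSum.isIsotopic` (Schubert's theorem),
geometric heart for rail knots, closure step (crossing retraction). Model geometry in blow-up
coordinates only (`ExitBend.lean`: `O = cO σ`, `dLo σ`, `dHi σ`): the excursion of a host knot lies
in the plane `P = O + span (dLo, dHi)`.

* **Oblique coordinates** `oblPt σ a c = O + a dLo + c dHi`, with the linear coordinate functions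
  `oblA`, `oblC` of `ℝ³` (depending on `Y₀, Y₁` only) recovering `a`, `c` on `P`.
* **The level functional** `lev Y = oblC Y + ε_P oblA Y` with the universal small constant
  `epsP = 1/(2 bendM + 8)`, `bendM = 6 C₀` (`C₀ = smoothTransitionDerivBound`, a bound for the
  angular speed of the exit-bend spiral): affine in `Y`, independent of `Y₂`, `2`-Lipschitz.
* **Levels along the excursion**: `ε_P t` on the lower line `O + t dLo`, and along the bent upper
  ray `ψ ↦ bendArc σ r_A ψ 1` the level `ψ cos φ + ε_P ψ sin φ` (`φ = (π/2) annulusCut r_A (ψ²)`)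
  has **positive derivative** (`deriv_levGen_pos`): the spiral is traversed with increasing level.
* **The target hairpin by level** `tgt m : ℝ²`: the lower line (read by level) for `m ≤ -ε_P/4`,
  blended to the `dHi`-line `(1 - 3m/4, m)` by `m = -ε_P/8`; its second coordinate is strictly
  increasing in the level (`deriv_tgt_one_pos`), it is Lipschitz in the level with a universal
  constant (`lipschitzWith_tgt`), and it stays in `1/4 ≤ Y₀ ≤ 5/4`, `|Y₁| ≤ 1` for levels in
  `[-ε_P, 1]`.

Everything is proved; no named facts are introduced.

## References

* M. W. Hirsch, *Differential Topology*, GTM 33, Springer (1976), Ch. 8 §1. [HirschDT1976]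
-/

open scoped ContDiff Topology Real
open Function Set Metric Filter

noncomputable section

namespace Literature.Topology.FourManifolds

/-- Local notation: `𝔼 n` is the model Euclidean space `EuclideanSpace ℝ (Fin n)`. -/
local notation "𝔼 " n:arg => EuclideanSpace ℝ (Fin n)

namespace ExitBend

variable (σ : ℝ)

/-! ### Oblique coordinates on the excursion plane -/

/-- **The oblique point** `O + a dLo + c dHi` of the excursion plane. [folklore] -/
def oblPt (a c : ℝ) : 𝔼 3 := cO σ + a • dLo σ + c • dHi σ

/-- Coordinates of an oblique point. [folklore] -/
@[simp] theorem oblPt_apply_zero (a c : ℝ) : oblPt σ a c 0 = 1 + 3 / 4 * a - 3 / 4 * c := by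
  simp [oblPt, cO, dLo, dHi]; ring

/-- Coordinates of an oblique point. [folklore] -/
@[simp] theorem oblPt_apply_one (a c : ℝ) : oblPt σ a c 1 = a + c := by
  simp [oblPt, cO, dLo, dHi]

/-- Coordinates of an oblique point. [folklore] -/
@[simp] theorem oblPt_apply_two (a c : ℝ) : oblPt σ a c 2 = σ * (1 + a - c) := by
  simp [oblPt, cO, dLo, dHi]; ring

/-- **The oblique coordinate `a`** as a function on `ℝ³` (depends on `Y₀, Y₁` only). [folklore] -/
def oblA (Y : 𝔼 3) : ℝ := (Y 1 + 4 / 3 * (Y 0 - 1)) / 2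

/-- **The oblique coordinate `c`** as a function on `ℝ³`. [folklore] -/
def oblC (Y : 𝔼 3) : ℝ := (Y 1 - 4 / 3 * (Y 0 - 1)) / 2

/-- `oblA` recovers `a`. [folklore] -/
@[simp] theorem oblA_oblPt (a c : ℝ) : oblA (oblPt σ a c) = a := by
  simp [oblA]; ring

/-- `oblC` recovers `c`. [folklore] -/
@[simp] theorem oblC_oblPt (a c : ℝ) : oblC (oblPt σ a c) = c := by
  simp [oblC]; ring

/-! ### The universal constants and the level functional -/

/-- **A bound for the angular speed of the exit-bend spiral**: `6 C₀`. [folklore] -/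
def bendM : ℝ := 6 * smoothTransitionDerivBound

/-- The bound is positive. [folklore] -/
theorem bendM_pos : 0 < bendM := by unfold bendM; have := smoothTransitionDerivBound_pos; positivity

/-- **The level slope** `ε_P = 1/(2 bendM + 8)`. [folklore] -/
def epsP : ℝ := 1 / (2 * bendM + 8)

/-- `0 < ε_P`. [folklore] -/
theorem epsP_pos : 0 < epsP := by unfold epsP; have := bendM_pos; positivity

/-- `ε_P ≤ 1/8`. [folklore] -/
theorem epsP_le : epsP ≤ 1 / 8 := by
  unfold epsP; have := bendM_pos
  rw [div_le_div_iff₀ (by positivity) (by norm_num)]; linarith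

/-- `bendM ε_P ≤ 1/2`. [folklore] -/
theorem bendM_mul_epsP_le : bendM * epsP ≤ 1 / 2 := by
  unfold epsP; have := bendM_pos
  rw [← mul_div_assoc, mul_one, div_le_div_iff₀ (by positivity) (by norm_num)]; linarith

/-- **The level functional** `lev Y = oblC Y + ε_P oblA Y`. [folklore] -/
def lev (Y : 𝔼 3) : ℝ := oblC Y + epsP * oblA Y

/-- The level in coordinates. [folklore] -/
theorem lev_eq (Y : 𝔼 3) : lev Y = (1 + epsP) / 2 * Y 1 - 2 / 3 * (1 - epsP) * (Y 0 - 1) := by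
  simp only [lev, oblC, oblA]; ring

/-- The level of an oblique point: `c + ε_P a`. [folklore] -/
@[simp] theorem lev_oblPt (a c : ℝ) : lev (oblPt σ a c) = c + epsP * a := by
  simp [lev]

/-- **The level functional is affine**: convex combinations. [folklore] -/
theorem lev_lineMap (Y Y' : 𝔼 3) (u : ℝ) : lev ((1 - u) • Y + u • Y') = (1 - u) * lev Y + u * lev Y' := by
  simp only [lev_eq, PiLp.add_apply, PiLp.smul_apply, smul_eq_mul]; ring

/-- The level depends on the first two coordinates only. [folklore] -/
theorem lev_congr {Y Y' : 𝔼 3} (h0 : Y 0 = Y' 0) (h1 : Y 1 = Y' 1) : lev Y = lev Y' := by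
  simp only [lev_eq, h0, h1]

/-- Differences of levels. [folklore] -/
theorem lev_sub (Y Y' : 𝔼 3) : lev Y - lev Y' = (1 + epsP) / 2 * (Y 1 - Y' 1) - 2 / 3 * (1 - epsP) * (Y 0 - Y' 0) := by
  simp only [lev_eq]; ring

/-- **The level functional is `2`-Lipschitz** (indeed `|lev Y - lev Y'| ≤ |Y₀ - Y'₀| + |Y₁ - Y'₁|`).
[folklore] -/
theorem abs_lev_sub_le (Y Y' : 𝔼 3) : |lev Y - lev Y'| ≤ 2 * ‖Y - Y'‖ := by
  have hε := epsP_pos; have hε' := epsP_le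
  have h0 : |Y 0 - Y' 0| ≤ ‖Y - Y'‖ := by
    have := PiLp.norm_apply_le (p := 2) (Y - Y') 0
    simpa [Real.norm_eq_abs] using this
  have h1 : |Y 1 - Y' 1| ≤ ‖Y - Y'‖ := by
    have := PiLp.norm_apply_le (p := 2) (Y - Y') 1
    simpa [Real.norm_eq_abs] using this
  have hA : |(1 + epsP) / 2 * (Y 1 - Y' 1)| ≤ 1 * ‖Y - Y'‖ := by
    rw [abs_mul, abs_of_pos (by positivity : 0 < (1 + epsP) / 2)]
    exact mul_le_mul (by linarith) h1 (abs_nonneg _) zero_le_one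
  have hB : |2 / 3 * (1 - epsP) * (Y 0 - Y' 0)| ≤ 1 * ‖Y - Y'‖ := by
    rw [abs_mul, abs_of_pos (by nlinarith : 0 < 2 / 3 * (1 - epsP))]
    exact mul_le_mul (by linarith) h0 (abs_nonneg _) zero_le_one
  rw [lev_sub]
  calc |(1 + epsP) / 2 * (Y 1 - Y' 1) - 2 / 3 * (1 - epsP) * (Y 0 - Y' 0)|
      ≤ |(1 + epsP) / 2 * (Y 1 - Y' 1)| + |2 / 3 * (1 - epsP) * (Y 0 - Y' 0)| := abs_sub _ _
    _ ≤ 1 * ‖Y - Y'‖ + 1 * ‖Y - Y'‖ := add_le_add hA hB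
    _ = 2 * ‖Y - Y'‖ := by ring

/-! ### Levels along the excursion -/

/-- **The lower line** `O + t dLo` (clock `t`). [folklore] -/
def lowerPt (t : ℝ) : 𝔼 3 := cO σ + t • dLo σ

/-- The lower line in oblique coordinates. [folklore] -/
theorem lowerPt_eq (t : ℝ) : lowerPt σ t = oblPt σ t 0 := by
  simp [lowerPt, oblPt]

/-- The level on the lower line: `ε_P t`. [folklore] -/
@[simp] theorem lev_lowerPt (t : ℝ) : lev (lowerPt σ t) = epsP * t := by
  rw [lowerPt_eq, lev_oblPt, zero_add]

/-- **The bend angle** `φ (ψ) = (π/2) annulusCut r_A (ψ²)`. [folklore] -/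
def bendAng (rA ψ : ℝ) : ℝ := π / 2 * annulusCut rA (ψ ^ 2)

/-- **The bent upper point** `ψ ↦ bendArc σ r_A ψ 1 = O + ψ sin φ dLo + ψ cos φ dHi`. [folklore] -/
def genPt (rA ψ : ℝ) : 𝔼 3 := bendArc σ rA ψ 1

/-- The bent upper point in oblique coordinates. [folklore] -/
theorem genPt_eq (rA ψ : ℝ) : genPt σ rA ψ = oblPt σ (ψ * Real.sin (bendAng rA ψ)) (ψ * Real.cos (bendAng rA ψ)) := by
  simp [genPt, bendArc, bendAng, oblPt, mul_one]

/-- **The level along the bent upper ray.** [folklore] -/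
def levGen (rA ψ : ℝ) : ℝ := ψ * Real.cos (bendAng rA ψ) + epsP * (ψ * Real.sin (bendAng rA ψ))

/-- The level of the bent upper point. [folklore] -/
theorem lev_genPt (rA ψ : ℝ) : lev (genPt σ rA ψ) = levGen rA ψ := by
  rw [genPt_eq, lev_oblPt, levGen]

/-- The bend angle lies in `[0, π/2]`. [folklore] -/
theorem bendAng_mem (rA ψ : ℝ) : bendAng rA ψ ∈ Icc 0 (π / 2) := by
  have h := annulusCut_mem_Icc rA (ψ ^ 2)
  have hπ : 0 < π / 2 := by positivity
  exact ⟨mul_nonneg hπ.le h.1, mul_le_of_le_one_right hπ.le h.2⟩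

/-- **On `[2 r_A, ∞)` the inner factor of the annular cut-off is `1`**: the cut-off is
`1 - smoothStep (1/4) (9/16)`. [folklore] -/
theorem annulusCut_eq_of_le {rA x : ℝ} (hrA : 0 < rA) (hx : 4 * rA ^ 2 ≤ x) :
    annulusCut rA x = 1 - smoothStep (1 / 4) (9 / 16) x := by
  rw [annulusCut, smoothStep_of_ge (by nlinarith) hx, one_mul]

/-- **Derivative of the bend angle** for `ψ ≥ 2 r_A`, `ψ > 0`: it is
`-(π/2) smoothTransition' ((ψ² - 1/4)/(5/16)) (16/5) 2ψ`, in particular nonpositive. [folklore] -/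
theorem hasDerivAt_bendAng {rA ψ : ℝ} (hrA : 0 < rA) (hψ : 2 * rA < ψ) :
    HasDerivAt (bendAng rA)
      (π / 2 * (-(deriv Real.smoothTransition ((ψ ^ 2 - 1 / 4) / (9 / 16 - 1 / 4)) * (9 / 16 - 1 / 4)⁻¹ * (2 * ψ)))) ψ := by
  -- near `ψ` the cut-off is `1 - smoothStep (1/4) (9/16) (ψ²)`
  have hev : bendAng rA =ᶠ[𝓝 ψ] fun ψ ↦ π / 2 * (1 - smoothStep (1 / 4) (9 / 16) (ψ ^ 2)) := by
    have hopen : IsOpen {ψ' : ℝ | 2 * rA < ψ'} := isOpen_lt continuous_const continuous_id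
    filter_upwards [hopen.mem_nhds hψ] with ψ' hψ'
    have h2 : 2 * rA < ψ' := hψ'
    have hsq : 4 * rA ^ 2 ≤ ψ' ^ 2 := by
      have := mul_pos (sub_pos.2 h2) (by linarith : 0 < ψ' + 2 * rA)
      nlinarith
    rw [bendAng, annulusCut_eq_of_le hrA hsq]
  have hS := (hasDerivAt_smoothStep (1 / 4) (9 / 16) (ψ ^ 2)).comp ψ (hasDerivAt_pow 2 ψ)
  have h2 := (hS.const_sub 1).const_mul (π / 2)
  refine (h2.congr_of_eventuallyEq hev).congr_deriv ?_
  push_cast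
  ring

/-- **The angular speed bound**: `|ψ φ'(ψ)| ≤ bendM` for `2 r_A < ψ ≤ 3/4`; and `φ' ≤ 0`. [folklore] -/
theorem abs_mul_deriv_bendAng_le {rA ψ : ℝ} (hrA : 0 < rA) (hψ : 2 * rA < ψ) (hψ1 : ψ ≤ 3 / 4) :
    |ψ * deriv (bendAng rA) ψ| ≤ bendM ∧ deriv (bendAng rA) ψ ≤ 0 := by
  have hψ0 : 0 < ψ := by nlinarith
  have hd := (hasDerivAt_bendAng hrA hψ).deriv
  set D := deriv Real.smoothTransition ((ψ ^ 2 - 1 / 4) / (9 / 16 - 1 / 4)) with hD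
  have hC := norm_deriv_smoothTransition_le ((ψ ^ 2 - 1 / 4) / (9 / 16 - 1 / 4))
  rw [Real.norm_eq_abs, ← hD] at hC
  have hC0 := smoothTransitionDerivBound_pos
  -- `smoothTransition' ≥ 0` (monotone)
  have hD0 : 0 ≤ D := by
    rw [hD]
    exact Real.smoothTransition.monotone.deriv_nonneg
  rw [hd]
  have hπ3 : π < 10 / 3 := by have := Real.pi_lt_d2; norm_num at this; linarith
  have hπ0 : 0 < π := Real.pi_pos
  constructor
  · rw [show ψ * (π / 2 * -(D * (9 / 16 - 1 / 4)⁻¹ * (2 * ψ))) = -(π * (16 / 5) * D * ψ ^ 2) by ring, abs_neg,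
      abs_of_nonneg (by positivity)]
    have hψ2 : ψ ^ 2 ≤ 9 / 16 := by nlinarith
    calc π * (16 / 5) * D * ψ ^ 2 ≤ (10 / 3) * (16 / 5) * smoothTransitionDerivBound * (9 / 16) := by
          gcongr
          exact le_of_abs_le hC
      _ = 6 * smoothTransitionDerivBound := by ring
      _ = bendM := rfl
  · have : 0 ≤ π / 2 * (D * (9 / 16 - 1 / 4)⁻¹ * (2 * ψ)) := by positivity
    linarith

/-- For `ψ ≥ 3/4` (indeed `ψ² ≥ 9/16` nearby) the bend angle is locally `0`. [folklore] -/
theorem deriv_bendAng_of_gt {rA ψ : ℝ} (hψ : 3 / 4 < ψ) : deriv (bendAng rA) ψ = 0 := by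
  have hev : bendAng rA =ᶠ[𝓝 ψ] fun _ ↦ (0 : ℝ) := by
    filter_upwards [Ioi_mem_nhds hψ] with ψ' hψ'
    have : 9 / 16 ≤ ψ' ^ 2 := by have : (3:ℝ) / 4 < ψ' := hψ'; nlinarith
    rw [bendAng, annulusCut_of_ge this, mul_zero]
  rw [hev.deriv_eq, deriv_const]

/-- **The level increases along the bent upper ray**: `levGen' > 0` for `2 r_A < ψ`, `ψ ≤ 1`
(`r_A > 0`). [folklore] -/
theorem deriv_levGen_pos {rA ψ : ℝ} (hrA : 0 < rA) (hψ : 2 * rA < ψ) (hψ1 : ψ ≤ 1) : 0 < deriv (levGen rA) ψ := by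
  have hψ0 : 0 < ψ := by nlinarith
  have hφd : HasDerivAt (bendAng rA) (deriv (bendAng rA) ψ) ψ := (hasDerivAt_bendAng hrA hψ).differentiableAt.hasDerivAt
  set φ := bendAng rA ψ with hφ
  set φ' := deriv (bendAng rA) ψ with hφ'
  -- the derivative of the level
  have hcos := (Real.hasDerivAt_cos φ).comp ψ hφd
  have hsin := (Real.hasDerivAt_sin φ).comp ψ hφd
  have h1 : HasDerivAt (fun ψ ↦ ψ * Real.cos (bendAng rA ψ)) (1 * Real.cos φ + ψ * (-Real.sin φ * φ')) ψ :=
    (hasDerivAt_id ψ).mul hcos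
  have h2 : HasDerivAt (fun ψ ↦ epsP * (ψ * Real.sin (bendAng rA ψ))) (epsP * (1 * Real.sin φ + ψ * (Real.cos φ * φ'))) ψ :=
    ((hasDerivAt_id ψ).mul hsin).const_mul epsP
  have hL : HasDerivAt (levGen rA) (1 * Real.cos φ + ψ * (-Real.sin φ * φ') + epsP * (1 * Real.sin φ + ψ * (Real.cos φ * φ'))) ψ :=
    h1.add h2
  rw [hL.deriv]
  have hmem := bendAng_mem rA ψ
  rw [← hφ] at hmem
  have hc0 : 0 ≤ Real.cos φ := Real.cos_nonneg_of_mem_Icc ⟨by linarith [hmem.1, Real.pi_pos], hmem.2⟩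
  have hs0 : 0 ≤ Real.sin φ := Real.sin_nonneg_of_mem_Icc ⟨hmem.1, by linarith [hmem.2, Real.pi_pos]⟩
  have hε := epsP_pos; have hε8 := epsP_le; have hMε := bendM_mul_epsP_le; have hM := bendM_pos
  -- `cos φ + ε sin φ > 0`
  have hpos : 0 < Real.cos φ + epsP * Real.sin φ := by
    rcases hc0.eq_or_lt with hc | hc
    · -- `cos φ = 0` forces `sin φ = 1`
      have : Real.sin φ = 1 := by
        have := Real.sin_sq_add_cos_sq φ; rw [← hc] at this
        nlinarith
      rw [← hc, this]; linarith
    · positivity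
  -- the angular term, with `|ψ φ'| ≤ bendM` and `φ' ≤ 0` (or `φ' = 0` for `ψ > 3/4`)
  have key : -(bendM * epsP) * Real.cos φ ≤ ψ * φ' * (epsP * Real.cos φ - Real.sin φ) := by
    by_cases h34 : ψ ≤ 3 / 4
    · obtain ⟨hb, hneg⟩ := abs_mul_deriv_bendAng_le hrA hψ h34
      rw [← hφ'] at hb hneg
      have hψφ : ψ * φ' ≤ 0 := mul_nonpos_of_nonneg_of_nonpos hψ0.le hneg
      have hψφ' : -bendM ≤ ψ * φ' := by have := neg_abs_le (ψ * φ'); linarith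
      have hL0 : -(bendM * epsP) * Real.cos φ ≤ 0 := by nlinarith [mul_pos hM hε, hc0]
      by_cases hsign : epsP * Real.cos φ - Real.sin φ ≤ 0
      · have : 0 ≤ ψ * φ' * (epsP * Real.cos φ - Real.sin φ) := mul_nonneg_of_nonpos_of_nonpos hψφ hsign
        linarith
      · push Not at hsign
        nlinarith
    · push Not at h34
      rw [hφ', deriv_bendAng_of_gt h34, mul_zero, zero_mul]
      nlinarith [mul_pos hM hε, hc0]
  nlinarith

/-! ### The target hairpin, parametrised by level -/

/-- Left end of the lower blend (level `-ε_P/4`, clock `-1/4`). [folklore] -/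
def mA : ℝ := -(epsP / 4)

/-- Right end of the lower blend (level `-ε_P/8`). [folklore] -/
def mB : ℝ := -(epsP / 8)

/-- `mA < mB < 0`. [folklore] -/
theorem mA_lt_mB : mA < mB ∧ mB < 0 := by unfold mA mB; have := epsP_pos; constructor <;> linarith

/-- The blend weight. [folklore] -/
def wgt (m : ℝ) : ℝ := smoothStep mA mB m

/-- **The target hairpin by level**: the lower line `(1 + 3t/4, t)`, `t = m/ε_P`, blended to the
`dHi`-line `(1 - 3m/4, m)`. [folklore] -/
def tgt (m : ℝ) : 𝔼 2 :=
  pt2 ((1 - wgt m) * (1 + 3 / 4 * (m / epsP)) + wgt m * (1 - 3 / 4 * m)) ((1 - wgt m) * (m / epsP) + wgt m * m)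

/-- First coordinate of the target. [folklore] -/
@[simp] theorem tgt_apply_zero (m : ℝ) : tgt m 0 = (1 - wgt m) * (1 + 3 / 4 * (m / epsP)) + wgt m * (1 - 3 / 4 * m) := rfl

/-- Second coordinate of the target. [folklore] -/
@[simp] theorem tgt_apply_one (m : ℝ) : tgt m 1 = (1 - wgt m) * (m / epsP) + wgt m * m := rfl

/-- **Low levels**: the target is the lower line read by level. [folklore] -/
theorem tgt_of_le {m : ℝ} (hm : m ≤ mA) : tgt m = pt2 (1 + 3 / 4 * (m / epsP)) (m / epsP) := by
  have : wgt m = 0 := smoothStep_of_le mA_lt_mB.1 hm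
  ext i; fin_cases i <;> simp [this]

/-- **High levels**: the target is the `dHi`-line. [folklore] -/
theorem tgt_of_ge {m : ℝ} (hm : mB ≤ m) : tgt m = pt2 (1 - 3 / 4 * m) m := by
  have : wgt m = 1 := smoothStep_of_ge mA_lt_mB.1 hm
  ext i; fin_cases i <;> simp [this]

/-- The target at the level of a low lower-line point is its projection. [folklore] -/
theorem tgt_lev_lowerPt {t : ℝ} (ht : t ≤ -(1 / 4)) : tgt (epsP * t) = pt2 (lowerPt σ t 0) (lowerPt σ t 1) := by
  have hε := epsP_pos
  have hm : epsP * t ≤ mA := by unfold mA; nlinarith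
  rw [tgt_of_le hm, mul_div_cancel_left₀ _ hε.ne', lowerPt_eq, oblPt_apply_zero, oblPt_apply_one]
  norm_num

/-- The target at a level `m ≥ 3/4` is the projection of the upper ray point `O + m dHi`. [folklore] -/
theorem tgt_of_ge_upper {m : ℝ} (hm : mB ≤ m) : tgt m = pt2 (oblPt σ 0 m 0) (oblPt σ 0 m 1) := by
  rw [tgt_of_ge hm, oblPt_apply_zero, oblPt_apply_one]; norm_num

/-- The target is `C^∞`. [folklore] -/
theorem contDiff_tgt : ContDiff ℝ ∞ tgt := by
  have hw : ContDiff ℝ ∞ wgt := contDiff_smoothStep _ _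
  rw [contDiff_euclidean]
  intro i; fin_cases i
  · exact ((contDiff_const.sub hw).mul (contDiff_const.add (contDiff_const.mul (contDiff_id.div_const _)))).add
      (hw.mul (contDiff_const.sub (contDiff_const.mul contDiff_id)))
  · exact ((contDiff_const.sub hw).mul (contDiff_id.div_const _)).add (hw.mul contDiff_id)

/-- The derivative of the blend weight: value and bound. [folklore] -/
theorem hasDerivAt_wgt (m : ℝ) : HasDerivAt wgt (deriv wgt m) m ∧ 0 ≤ deriv wgt m ∧ |deriv wgt m| ≤ 8 * smoothTransitionDerivBound / epsP := by
  have hd := hasDerivAt_smoothStep mA mB m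
  have hε := epsP_pos
  have hw : mB - mA = epsP / 8 := by unfold mA mB; ring
  refine ⟨(((contDiff_smoothStep mA mB).differentiable (by simp)) m).hasDerivAt, deriv_smoothStep_nonneg mA_lt_mB.1 m, ?_⟩
  rw [show wgt = smoothStep mA mB from rfl, hd.deriv, hw, abs_mul, abs_inv, abs_of_pos (by positivity : 0 < epsP / 8)]
  have hC := norm_deriv_smoothTransition_le ((m - mA) / (epsP / 8))
  rw [Real.norm_eq_abs] at hC
  calc |deriv Real.smoothTransition ((m - mA) / (epsP / 8))| * (epsP / 8)⁻¹
      ≤ smoothTransitionDerivBound * (epsP / 8)⁻¹ := by gcongr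
    _ = 8 * smoothTransitionDerivBound / epsP := by field_simp

/-- **The second coordinate of the target is strictly increasing in the level**, with derivative
`≥ 1`. [folklore] -/
theorem deriv_tgt_one_pos (m : ℝ) : HasDerivAt (fun m ↦ tgt m 1) (deriv (fun m ↦ tgt m 1) m) m ∧ 1 ≤ deriv (fun m ↦ tgt m 1) m := by
  obtain ⟨hw, hw0, -⟩ := hasDerivAt_wgt m
  have hε := epsP_pos; have hε8 := epsP_le
  have h1 : HasDerivAt (fun m ↦ (1 - wgt m) * (m / epsP)) (-deriv wgt m * (m / epsP) + (1 - wgt m) * epsP⁻¹) m := by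
    have := (hw.const_sub 1).mul ((hasDerivAt_id m).div_const epsP)
    simp only [id_eq, one_div] at this
    exact this
  have h2 : HasDerivAt (fun m ↦ wgt m * m) (deriv wgt m * m + wgt m * 1) m := hw.mul (hasDerivAt_id m)
  have h : HasDerivAt (fun m ↦ tgt m 1) (-deriv wgt m * (m / epsP) + (1 - wgt m) * epsP⁻¹ + (deriv wgt m * m + wgt m * 1)) m :=
    h1.add h2
  refine ⟨h.differentiableAt.hasDerivAt, ?_⟩
  rw [h.deriv]
  have hwm := smoothStep_mem_Icc mA mB m
  change wgt m ∈ Icc (0 : ℝ) 1 at hwm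
  -- where `wgt' ≠ 0` we have `m ≤ mB < 0`, so the `wgt'` terms contribute nonnegatively
  have hterm : 0 ≤ deriv wgt m * m - deriv wgt m * (m / epsP) := by
    by_cases hm : m ≤ mB
    · have hm0 : m ≤ 0 := hm.trans mA_lt_mB.2.le
      have : m / epsP ≤ m := by
        rw [div_le_iff₀ hε]; nlinarith
      nlinarith
    · push Not at hm
      have : deriv wgt m = 0 := deriv_smoothStep_of_gt mA_lt_mB.1 hm
      rw [this]; simp
  have h1e : 1 ≤ epsP⁻¹ := by rw [le_inv_comm₀ one_pos hε, inv_one]; linarith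
  have hA : (1 - wgt m) * 1 ≤ (1 - wgt m) * epsP⁻¹ := mul_le_mul_of_nonneg_left h1e (by linarith [hwm.2])
  nlinarith [hwm.1, hwm.2]

/-- The derivative of the target in coordinates. [folklore] -/
theorem hasDerivAt_tgt (m : ℝ) :
    HasDerivAt tgt (pt2 (deriv (fun m ↦ tgt m 0) m) (deriv (fun m ↦ tgt m 1) m)) m := by
  have h0 : HasDerivAt (fun m ↦ tgt m 0) (deriv (fun m ↦ tgt m 0) m) m :=
    (((contDiff_euclidean.1 contDiff_tgt 0).differentiable (by simp)) m).hasDerivAt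
  have h1 : HasDerivAt (fun m ↦ tgt m 1) (deriv (fun m ↦ tgt m 1) m) m :=
    (((contDiff_euclidean.1 contDiff_tgt 1).differentiable (by simp)) m).hasDerivAt
  have := hasDerivAt_pt2 h0 h1
  have e : (fun x ↦ pt2 (tgt x 0) (tgt x 1)) = tgt := by funext x; ext i; fin_cases i <;> rfl
  rwa [e] at this

/-- **A universal Lipschitz constant for the target.** [folklore] -/
def tgtLip : ℝ := 40 * smoothTransitionDerivBound / epsP + 2 / epsP + 3

/-- The Lipschitz constant is positive. [folklore] -/
theorem tgtLip_pos : 0 < tgtLip := by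
  unfold tgtLip; have := smoothTransitionDerivBound_pos; have := epsP_pos; positivity

/-- Bound for the derivative of the first coordinate of the target. [folklore] -/
theorem abs_deriv_tgt_zero_le (m : ℝ) : |deriv (fun m ↦ tgt m 0) m| ≤ 24 * smoothTransitionDerivBound / epsP + 1 / epsP + 1 := by
  obtain ⟨hw, hw0, hwb⟩ := hasDerivAt_wgt m
  have hε := epsP_pos; have hε8 := epsP_le; have hC := smoothTransitionDerivBound_pos
  have h : HasDerivAt (fun m ↦ tgt m 0)
      (-deriv wgt m * (1 + 3 / 4 * (m / epsP)) + (1 - wgt m) * (3 / 4 * epsP⁻¹) +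
        (deriv wgt m * (1 - 3 / 4 * m) + wgt m * (-(3 / 4)))) m := by
    have h1 : HasDerivAt (fun m ↦ (1 - wgt m) * (1 + 3 / 4 * (m / epsP)))
        (-deriv wgt m * (1 + 3 / 4 * (m / epsP)) + (1 - wgt m) * (3 / 4 * epsP⁻¹)) m := by
      have := (hw.const_sub 1).mul ((((hasDerivAt_id m).div_const epsP).const_mul (3 / 4)).const_add 1)
      simp only [id_eq, one_div] at this
      exact this
    have h2 : HasDerivAt (fun m ↦ wgt m * (1 - 3 / 4 * m)) (deriv wgt m * (1 - 3 / 4 * m) + wgt m * (-(3 / 4))) m := by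
      have := hw.mul (((hasDerivAt_id m).const_mul (3 / 4 : ℝ)).const_sub 1)
      simp only [id_eq, mul_one] at this
      exact this.congr_deriv (by ring)
    exact h1.add h2
  rw [h.deriv]
  have hwm := smoothStep_mem_Icc mA mB m
  change wgt m ∈ Icc (0 : ℝ) 1 at hwm
  -- the `wgt'` terms: nonzero only for `m ∈ (mA, mB)`, where the brackets are bounded
  have hterm : |-deriv wgt m * (1 + 3 / 4 * (m / epsP)) + deriv wgt m * (1 - 3 / 4 * m)| ≤ 24 * smoothTransitionDerivBound / epsP := by
    by_cases hm : m ∈ Ioo mA mB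
    · have hmA : -(epsP / 4) < m := hm.1
      have hmB : m < 0 := hm.2.trans mA_lt_mB.2
      have hb1 : |1 + 3 / 4 * (m / epsP)| ≤ 1 := by
        rw [abs_le]; constructor
        · have : -(1 / 4) < m / epsP := by rw [lt_div_iff₀ hε]; linarith
          linarith
        · have : m / epsP < 0 := div_neg_of_neg_of_pos hmB hε
          linarith
      have hb2 : |1 - 3 / 4 * m| ≤ 2 := by rw [abs_le]; constructor <;> nlinarith
      calc |-deriv wgt m * (1 + 3 / 4 * (m / epsP)) + deriv wgt m * (1 - 3 / 4 * m)|
          ≤ |-deriv wgt m * (1 + 3 / 4 * (m / epsP))| + |deriv wgt m * (1 - 3 / 4 * m)| := abs_add_le _ _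
        _ = |deriv wgt m| * |1 + 3 / 4 * (m / epsP)| + |deriv wgt m| * |1 - 3 / 4 * m| := by
            rw [abs_mul, abs_mul, abs_neg]
        _ ≤ (8 * smoothTransitionDerivBound / epsP) * 1 + (8 * smoothTransitionDerivBound / epsP) * 2 := by
            gcongr
        _ = 24 * smoothTransitionDerivBound / epsP := by ring
    · have : deriv wgt m = 0 := by
        rw [mem_Ioo, not_and_or, not_lt, not_lt] at hm
        rcases hm with hm | hm
        · rcases hm.eq_or_lt with hm' | hm'
          · rw [hm']; exact deriv_smoothStep_left mA mB
          · exact deriv_smoothStep_of_lt mA_lt_mB.1 hm'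
        · rcases hm.eq_or_lt with hm' | hm'
          · rw [← hm']; exact deriv_smoothStep_right mA_lt_mB.1
          · exact deriv_smoothStep_of_gt mA_lt_mB.1 hm'
      rw [this]; simp; positivity
  have h3 : |(1 - wgt m) * (3 / 4 * epsP⁻¹)| ≤ 1 / epsP := by
    rw [abs_of_nonneg (by have := hwm.2; positivity), one_div]
    nlinarith [hwm.1, hwm.2, inv_pos.2 hε]
  have h4 : |wgt m * (-(3 / 4))| ≤ 1 := by rw [abs_le]; constructor <;> nlinarith [hwm.1, hwm.2]
  calc |-deriv wgt m * (1 + 3 / 4 * (m / epsP)) + (1 - wgt m) * (3 / 4 * epsP⁻¹) + (deriv wgt m * (1 - 3 / 4 * m) + wgt m * (-(3 / 4)))|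
      = |(-deriv wgt m * (1 + 3 / 4 * (m / epsP)) + deriv wgt m * (1 - 3 / 4 * m)) + (1 - wgt m) * (3 / 4 * epsP⁻¹) + wgt m * (-(3 / 4))| := by
        ring_nf
    _ ≤ |(-deriv wgt m * (1 + 3 / 4 * (m / epsP)) + deriv wgt m * (1 - 3 / 4 * m)) + (1 - wgt m) * (3 / 4 * epsP⁻¹)| + |wgt m * (-(3 / 4))| :=
        abs_add_le _ _
    _ ≤ |-deriv wgt m * (1 + 3 / 4 * (m / epsP)) + deriv wgt m * (1 - 3 / 4 * m)| + |(1 - wgt m) * (3 / 4 * epsP⁻¹)| + |wgt m * (-(3 / 4))| := by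
        gcongr; exact abs_add_le _ _
    _ ≤ 24 * smoothTransitionDerivBound / epsP + 1 / epsP + 1 := by linarith

/-- Bound for the derivative of the second coordinate of the target. [folklore] -/
theorem abs_deriv_tgt_one_le (m : ℝ) : |deriv (fun m ↦ tgt m 1) m| ≤ 8 * smoothTransitionDerivBound / epsP + 1 / epsP + 1 := by
  obtain ⟨hw, hw0, hwb⟩ := hasDerivAt_wgt m
  have hε := epsP_pos; have hε8 := epsP_le; have hC := smoothTransitionDerivBound_pos
  have h1 : HasDerivAt (fun m ↦ (1 - wgt m) * (m / epsP)) (-deriv wgt m * (m / epsP) + (1 - wgt m) * epsP⁻¹) m := by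
    have := (hw.const_sub 1).mul ((hasDerivAt_id m).div_const epsP)
    simp only [id_eq, one_div] at this
    exact this
  have h2 : HasDerivAt (fun m ↦ wgt m * m) (deriv wgt m * m + wgt m * 1) m := hw.mul (hasDerivAt_id m)
  have h : HasDerivAt (fun m ↦ tgt m 1) (-deriv wgt m * (m / epsP) + (1 - wgt m) * epsP⁻¹ + (deriv wgt m * m + wgt m * 1)) m :=
    h1.add h2
  rw [h.deriv]
  have hwm := smoothStep_mem_Icc mA mB m
  change wgt m ∈ Icc (0 : ℝ) 1 at hwm
  have hterm : |-deriv wgt m * (m / epsP) + deriv wgt m * m| ≤ 8 * smoothTransitionDerivBound / epsP := by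
    by_cases hm : m ∈ Ioo mA mB
    · have hmA : -(epsP / 4) < m := hm.1
      have hmB : m < 0 := hm.2.trans mA_lt_mB.2
      have hb1 : |m / epsP| ≤ 1 / 2 := by
        rw [abs_le]; constructor
        · have : -(1 / 4) < m / epsP := by rw [lt_div_iff₀ hε]; linarith
          linarith
        · have : m / epsP < 0 := div_neg_of_neg_of_pos hmB hε
          linarith
      have hb2 : |m| ≤ 1 / 2 := by rw [abs_le]; constructor <;> nlinarith
      calc |-deriv wgt m * (m / epsP) + deriv wgt m * m|
          ≤ |-deriv wgt m * (m / epsP)| + |deriv wgt m * m| := abs_add_le _ _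
        _ = |deriv wgt m| * |m / epsP| + |deriv wgt m| * |m| := by rw [abs_mul, abs_mul, abs_neg]
        _ ≤ (8 * smoothTransitionDerivBound / epsP) * (1 / 2) + (8 * smoothTransitionDerivBound / epsP) * (1 / 2) := by gcongr
        _ = 8 * smoothTransitionDerivBound / epsP := by ring
    · have : deriv wgt m = 0 := by
        rw [mem_Ioo, not_and_or, not_lt, not_lt] at hm
        rcases hm with hm | hm
        · rcases hm.eq_or_lt with hm' | hm'
          · rw [hm']; exact deriv_smoothStep_left mA mB
          · exact deriv_smoothStep_of_lt mA_lt_mB.1 hm'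
        · rcases hm.eq_or_lt with hm' | hm'
          · rw [← hm']; exact deriv_smoothStep_right mA_lt_mB.1
          · exact deriv_smoothStep_of_gt mA_lt_mB.1 hm'
      rw [this]; simp; positivity
  have h3 : |(1 - wgt m) * epsP⁻¹| ≤ 1 / epsP := by
    rw [abs_of_nonneg (by have := hwm.2; positivity), one_div]; nlinarith [hwm.1, hwm.2, inv_pos.2 hε]
  have h4 : |wgt m * 1| ≤ 1 := by rw [abs_le]; constructor <;> nlinarith [hwm.1, hwm.2]
  calc |-deriv wgt m * (m / epsP) + (1 - wgt m) * epsP⁻¹ + (deriv wgt m * m + wgt m * 1)|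
      = |(-deriv wgt m * (m / epsP) + deriv wgt m * m) + (1 - wgt m) * epsP⁻¹ + wgt m * 1| := by ring_nf
    _ ≤ |(-deriv wgt m * (m / epsP) + deriv wgt m * m) + (1 - wgt m) * epsP⁻¹| + |wgt m * 1| := abs_add_le _ _
    _ ≤ |-deriv wgt m * (m / epsP) + deriv wgt m * m| + |(1 - wgt m) * epsP⁻¹| + |wgt m * 1| := by
        gcongr; exact abs_add_le _ _
    _ ≤ 8 * smoothTransitionDerivBound / epsP + 1 / epsP + 1 := by linarith

/-- **The target is Lipschitz in the level** with the universal constant `tgtLip`. [folklore] -/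
theorem norm_tgt_sub_le (m m' : ℝ) : ‖tgt m - tgt m'‖ ≤ tgtLip * |m - m'| := by
  have hdiff : ∀ x ∈ (univ : Set ℝ), DifferentiableAt ℝ tgt x := fun x _ ↦ (hasDerivAt_tgt x).differentiableAt
  have hbound : ∀ x ∈ (univ : Set ℝ), ‖deriv tgt x‖ ≤ tgtLip := fun x _ ↦ by
    rw [(hasDerivAt_tgt x).deriv]
    refine (BandData.norm_pt2_le _ _).trans ?_
    have h0 := abs_deriv_tgt_zero_le x; have h1 := abs_deriv_tgt_one_le x
    have hε := epsP_pos; have hC := smoothTransitionDerivBound_pos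
    unfold tgtLip
    have hpos : 0 ≤ smoothTransitionDerivBound / epsP := by positivity
    have e1 : 24 * smoothTransitionDerivBound / epsP + 8 * smoothTransitionDerivBound / epsP ≤ 40 * smoothTransitionDerivBound / epsP := by
      rw [← add_div, div_le_div_iff_of_pos_right hε]; nlinarith
    have e2 : 1 / epsP + 1 / epsP = 2 / epsP := by ring
    linarith
  have := Convex.norm_image_sub_le_of_norm_deriv_le hdiff hbound convex_univ (mem_univ m') (mem_univ m)
  rwa [← Real.norm_eq_abs]

/-! ### Where the target lies -/

/-- **The second coordinate of the target is increasing in the level.** [folklore] -/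
theorem tgt_one_le_tgt_one {m m' : ℝ} (h : m ≤ m') : tgt m 1 ≤ tgt m' 1 := by
  have hmono : Monotone fun m ↦ tgt m 1 :=
    monotone_of_deriv_nonneg (fun m ↦ (deriv_tgt_one_pos m).1.differentiableAt) (fun m ↦ by linarith [(deriv_tgt_one_pos m).2])
  exact hmono h

/-- The second coordinate of the target is strictly increasing in the level. [folklore] -/
theorem tgt_one_lt_tgt_one {m m' : ℝ} (h : m < m') : tgt m 1 < tgt m' 1 := by
  have hmono : StrictMono fun m ↦ tgt m 1 :=
    strictMono_of_deriv_pos (fun m ↦ by linarith [(deriv_tgt_one_pos m).2])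
  exact hmono h

/-- The target gains at least the level difference in the second coordinate. [folklore] -/
theorem sub_le_tgt_one_sub {m m' : ℝ} (h : m ≤ m') : m' - m ≤ tgt m' 1 - tgt m 1 := by
  -- `t ↦ tgt t 1 - t` is monotone
  have hd : ∀ t, HasDerivAt (fun t ↦ tgt t 1 - t) (deriv (fun m ↦ tgt m 1) t - 1) t := fun t ↦
    (deriv_tgt_one_pos t).1.sub (hasDerivAt_id t)
  have hmono : Monotone fun t ↦ tgt t 1 - t :=
    monotone_of_deriv_nonneg (fun t ↦ (hd t).differentiableAt)
      (fun t ↦ by rw [(hd t).deriv]; linarith [(deriv_tgt_one_pos t).2])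
  have := hmono h
  simp only at this
  linarith

/-- **Bounds for the target** on levels in `[-ε_P, 1]`: `1/4 ≤ Y₀ ≤ 5/4`, `-1 ≤ Y₁ ≤ 1`. [folklore] -/
theorem tgt_mem {m : ℝ} (hm : m ∈ Icc (-epsP) 1) : tgt m 0 ∈ Icc (1 / 4 : ℝ) (5 / 4) ∧ tgt m 1 ∈ Icc (-1 : ℝ) 1 := by
  have hε := epsP_pos; have hε8 := epsP_le
  have hwm := smoothStep_mem_Icc mA mB m
  change wgt m ∈ Icc (0 : ℝ) 1 at hwm
  have hq : m / epsP ∈ Icc (-1 : ℝ) (1 / epsP) := by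
    constructor
    · rw [le_div_iff₀ hε]; linarith [hm.1]
    · exact div_le_div_of_nonneg_right hm.2 hε.le
  simp only [tgt_apply_zero, tgt_apply_one]
  by_cases hlo : m ≤ mA
  · have hw : wgt m = 0 := smoothStep_of_le mA_lt_mB.1 hlo
    have h1 : m / epsP ≤ -(1 / 4) := by rw [div_le_iff₀ hε]; unfold mA at hlo; linarith
    rw [hw]
    refine ⟨⟨?_, ?_⟩, ?_, ?_⟩ <;> nlinarith [hq.1]
  by_cases hhi : mB ≤ m
  · have hw : wgt m = 1 := smoothStep_of_ge mA_lt_mB.1 hhi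
    have h1 : -(epsP / 8) ≤ m := hhi
    rw [hw]
    refine ⟨⟨?_, ?_⟩, ?_, ?_⟩ <;> nlinarith [hm.2]
  push Not at hlo hhi
  have hmA : -(epsP / 4) < m := hlo
  have hmB : m < -(epsP / 8) := hhi
  have hq1 : m / epsP ∈ Ioo (-(1 / 4) : ℝ) 0 := by
    constructor
    · rw [lt_div_iff₀ hε]; linarith
    · exact div_neg_of_neg_of_pos (by linarith) hε
  refine ⟨⟨?_, ?_⟩, ?_, ?_⟩ <;> nlinarith [hwm.1, hwm.2, hq1.1, hq1.2]

end ExitBend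

end Literature.Topology.FourManifolds
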